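/-
Copyright: cell `pub-balaban-gaps` (G2), seat ne6 (row NE7b), `prover-pub-balaban-gaps-ne6-g20-0`. Project licence.
-/
import Summits.QuantumFields.BalabanUV.T4Continuum.Spine.NE7b.CompactFibreMeanActionSUNDeriv

/-!
# A QUADRATIC FLOOR UNDER THE ONE-PLAQUETTE FREE ENERGY, EVERY `N ≥ 2`, EVERY REAL `β`: `Var_β(Re tr(1−V)) ≤ N²`, HENCE
# `N·β − (N²∕2)·β² ≤ −log Z_N(β) ≤ N·β` AND `N − N²β ≤ ⟨s⟩_β ≤ N` FOR `β ≥ 0` (row NE7b, node U5c; MODEL, [folklore]; census V60)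

Cell `pub-balaban-gaps` (G2 spine census) for the `pub-balaban` T⁴ crux NE7b (`T4WeightBudget.RelWeightBound`; NOT PRINTED, NOT PROVED).  Crux-route work under
`Spine/NE7b/`; imports the landed V56 `CompactFibreMeanActionSUNDeriv` (`integral_sq_sub_mul_exp_eq`, `hasDerivAt_meanAction_SUN`; it re-exports V50's
`hasDerivAt_freeEnergy_SUN`, `meanAction_zero`, `plaquetteMass_SUN_pos_real`, `freeEnergy_SUN_le` and V35∕V38's `0 ≤ Re tr(1−V) ≤ 2N`) + Mathlib
(`monotone_of_deriv_nonneg`, `monotoneOn_of_deriv_nonneg`, `antitoneOn_of_deriv_nonpos`); no `def`, zero `sorry`, nothing of Bałaban's asserted.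

THE LOCATED QUESTION.  The census has the tangent CEILING `−log Z_N(β) ≤ Nβ` (V46∕V50; strict off `0` by V57) and, at `β → 0`, the germ `Nβ − ½Var₀β²` (V58) — but no
explicit two-sided bound UNIFORM in `β` with constants depending on `N` only.  QUESTION (V60): one.  ANSWER ([folklore], `s = Re tr(1−V)`, one `SU(N)` plaquette under Haar,
`Z, M, W` the tilted moments):
* §1 **`integral_sq_sub_mul_exp_le`** (`∫(s − N)²e^{−βs} ≤ N²·Z`: `∣s − N∣ ≤ N`), **`actionVariance_SUN_le_sq`**: `W∕Z − (M∕Z)² ≤ N²` for every real `β` (Popoviciu: the mean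
  minimises `c ↦ ∫(s − c)²e^{−βs}`, V56's expansion at `c = M∕Z` and `c = N`);
* §2 with `g(β) = −log Z_N(β) − Nβ + (N²∕2)β²`: **`hasDerivAt_gap_SUN`** (`g′ = ⟨s⟩_β − N + N²β`), **`gapDeriv_SUN_monotone`** (`g″ = N² − Var_β ≥ 0`), the sign of `g′` on each
  side of `0` (`g′(0) = 0`, V50's `⟨s⟩₀ = N`), hence **`meanAction_ge_linear`**: `N − N²β ≤ ⟨s⟩_β` for `β ≥ 0` and **`meanAction_le_linear`**: `⟨s⟩_β ≤ N − N²β` for `β ≤ 0`;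
* §3 **`freeEnergy_SUN_quadratic_floor`**: `N·β − (N²∕2)·β² ≤ −log Z_N(β)` for EVERY REAL `β` (`g` is antitone on `(−∞,0]`, monotone on `[0,∞)`, `g(0) = 0`), and the
  SANDWICH **`freeEnergy_SUN_mem_Icc`**: `−log Z_N(β) ∈ [Nβ − (N²∕2)β², Nβ]` — explicit, uniform in `β`, constants `N` and `N²∕2` only.

HONEST REMARKS.  (i) MODEL ∕ [folklore]: Haar calculus of ONE `SU(N)` plaquette variable — NOT the interacting measure.  (ii) The variance bound `N²` is Popoviciu's for a
variable in `[0, 2N]`; the true `Var₀` is `½` (`N ≥ 3`) ∕ `1` (`N = 2`) (V51∕V58) — the floor is NOT sharp, only uniform.  (iii) (A3) ∕ (A1c) NOT asserted; NC-NE7b-α UNRULED.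
BY-NAME EFFECT ON THE WALL: NONE.  NE7b NOT PRINTED ∕ NOT PROVED; spine PROVED 0∕9; rung (B)+1 on ONE finite T⁴ — NOT infinite volume, NOT the mass gap, NOT Clay.
HONEST DEPENDENCY: continuum YM on T⁴ ⇐ BetaPertH ∧ nine spine estimates (0/9 proved); BetaPertH ⇐ (D1) ∧ (D4) ∧ CAP+tail;
G-an2-4 gates asym, D1 and NE2/3/4.  This file changes none of it.
-/

set_option autoImplicit false

noncomputable section

open Real Set MeasureTheory Filter Topology
open Literature.MathematicalPhysics.QuantumFieldTheory (haarProbability)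
open Summit.QuantumFields.BalabanUV.T4Continuum.NE7b.CompactFibreHalvedActionSUN (measurable_re_trace_one_sub re_trace_one_sub_le_two_mul)
open Summit.QuantumFields.BalabanUV.T4Continuum.NE7b.CompactFibreProfileVolumeSUN (re_trace_one_sub_nonneg)
open Summit.QuantumFields.BalabanUV.T4Continuum.NE7b.CompactFibrePlaquetteMassSUNTangentFloor (continuous_re_trace_one_sub)
open Summit.QuantumFields.BalabanUV.T4Continuum.NE7b.CompactFibreMeanActionSUNMonotone (hasDerivAt_freeEnergy_SUN meanAction_zero plaquetteMass_SUN_pos_real freeEnergy_SUN_le)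
open Summit.QuantumFields.BalabanUV.T4Continuum.NE7b.CompactFibreMeanActionSUNDeriv (integral_sq_sub_mul_exp_eq hasDerivAt_meanAction_SUN)

namespace Summit.QuantumFields.BalabanUV.T4Continuum.NE7b.CompactFibreFreeEnergySUNQuadraticFloor

variable {N : ℕ}

/-! ### §1 Popoviciu: the tilted variance is at most `N²` -/

/-- **`∫ (Re tr(1−V) − N)²·e^{−β Re tr(1−V)} dHaar ≤ N²·Z_N(β)`** (every real `β`): pointwise `(s − N)² ≤ N²` from `0 ≤ s ≤ 2N`. [folklore] -/
theorem integral_sq_sub_mul_exp_le (β : ℝ) :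
    ∫ V, ((Matrix.trace (1 - (V : Matrix (Fin N) (Fin N) ℂ))).re - (N : ℝ)) ^ 2 * Real.exp (-(β * (Matrix.trace (1 - (V : Matrix (Fin N) (Fin N) ℂ))).re))
        ∂(haarProbability (Matrix.specialUnitaryGroup (Fin N) ℂ))
      ≤ (N : ℝ) ^ 2 * ∫ V, Real.exp (-(β * (Matrix.trace (1 - (V : Matrix (Fin N) (Fin N) ℂ))).re)) ∂(haarProbability (Matrix.specialUnitaryGroup (Fin N) ℂ)) := by
  rw [← integral_const_mul]
  have hs := continuous_re_trace_one_sub (N := N)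
  have hcont : Continuous fun V : Matrix.specialUnitaryGroup (Fin N) ℂ =>
      (N : ℝ) ^ 2 * Real.exp (-(β * (Matrix.trace (1 - (V : Matrix (Fin N) (Fin N) ℂ))).re)) :=
    continuous_const.mul (Real.continuous_exp.comp (continuous_const.mul hs).neg)
  refine integral_mono_of_nonneg (Eventually.of_forall fun V => mul_nonneg (sq_nonneg _) (Real.exp_pos _).le)
    (hcont.integrable_of_hasCompactSupport (HasCompactSupport.of_compactSpace _)) (Eventually.of_forall fun V => ?_)
  have h0 := re_trace_one_sub_nonneg V
  have h2 := re_trace_one_sub_le_two_mul V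
  have hsq : ((Matrix.trace (1 - (V : Matrix (Fin N) (Fin N) ℂ))).re - (N : ℝ)) ^ 2 ≤ (N : ℝ) ^ 2 := by nlinarith
  exact mul_le_mul_of_nonneg_right hsq (Real.exp_pos _).le

/-- **POPOVICIU FOR THE TILTED WEIGHT, EVERY `N`, EVERY REAL `β`**: `Var_β(Re tr(1−V)) = W∕Z − (M∕Z)² ≤ N²` (the mean minimises `c ↦ ∫(s − c)²e^{−βs}`; at `c = N` the
integral is at most `N²·Z`). [folklore] -/
theorem actionVariance_SUN_le_sq (β : ℝ) :
    (∫ V, (Matrix.trace (1 - (V : Matrix (Fin N) (Fin N) ℂ))).re ^ 2 * Real.exp (-(β * (Matrix.trace (1 - (V : Matrix (Fin N) (Fin N) ℂ))).re))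
          ∂(haarProbability (Matrix.specialUnitaryGroup (Fin N) ℂ)))
        / (∫ V, Real.exp (-(β * (Matrix.trace (1 - (V : Matrix (Fin N) (Fin N) ℂ))).re)) ∂(haarProbability (Matrix.specialUnitaryGroup (Fin N) ℂ)))
      - ((∫ V, (Matrix.trace (1 - (V : Matrix (Fin N) (Fin N) ℂ))).re * Real.exp (-(β * (Matrix.trace (1 - (V : Matrix (Fin N) (Fin N) ℂ))).re))
            ∂(haarProbability (Matrix.specialUnitaryGroup (Fin N) ℂ)))
          / ∫ V, Real.exp (-(β * (Matrix.trace (1 - (V : Matrix (Fin N) (Fin N) ℂ))).re)) ∂(haarProbability (Matrix.specialUnitaryGroup (Fin N) ℂ))) ^ 2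
      ≤ (N : ℝ) ^ 2 := by
  have hZ := plaquetteMass_SUN_pos_real (N := N) β
  set Z := ∫ V, Real.exp (-(β * (Matrix.trace (1 - (V : Matrix (Fin N) (Fin N) ℂ))).re)) ∂(haarProbability (Matrix.specialUnitaryGroup (Fin N) ℂ)) with hZdef
  set M := ∫ V, (Matrix.trace (1 - (V : Matrix (Fin N) (Fin N) ℂ))).re * Real.exp (-(β * (Matrix.trace (1 - (V : Matrix (Fin N) (Fin N) ℂ))).re))
    ∂(haarProbability (Matrix.specialUnitaryGroup (Fin N) ℂ)) with hMdef
  set W := ∫ V, (Matrix.trace (1 - (V : Matrix (Fin N) (Fin N) ℂ))).re ^ 2 * Real.exp (-(β * (Matrix.trace (1 - (V : Matrix (Fin N) (Fin N) ℂ))).re))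
    ∂(haarProbability (Matrix.specialUnitaryGroup (Fin N) ℂ)) with hWdef
  have hN := integral_sq_sub_mul_exp_le (N := N) β
  rw [integral_sq_sub_mul_exp_eq (haarProbability (Matrix.specialUnitaryGroup (Fin N) ℂ)) measurable_re_trace_one_sub
    re_trace_one_sub_nonneg (re_trace_one_sub_le_two_mul (N := N)) β (N : ℝ)] at hN
  rw [← hZdef, ← hMdef, ← hWdef] at hN
  -- `W ≤ 2NM` (from `hN`) and `2NM·Z ≤ M² + N²Z²` (from `(NZ − M)² ≥ 0`) give `W·Z ≤ M² + N²Z²`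
  have hsq : 0 ≤ ((N : ℝ) * Z - M) ^ 2 := sq_nonneg _
  have hW : W ≤ 2 * (N : ℝ) * M := by linarith
  have key : W * Z ≤ M ^ 2 + (N : ℝ) ^ 2 * Z ^ 2 := by nlinarith
  have e : W / Z - (M / Z) ^ 2 = (W * Z - M ^ 2) / Z ^ 2 := by
    field_simp
  rw [e, div_le_iff₀ (pow_pos hZ 2)]
  linarith

/-! ### §2 The convex gap function `g(β) = −log Z_N(β) − Nβ + (N²∕2)β²` -/

/-- **`g′(β) = ⟨s⟩_β − N + N²β`** for `g(β) = −log Z_N(β) − Nβ + (N²∕2)β²`. [folklore] -/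
theorem hasDerivAt_gap_SUN (β : ℝ) :
    HasDerivAt (fun b : ℝ =>
        -Real.log (∫ V, Real.exp (-(b * (Matrix.trace (1 - (V : Matrix (Fin N) (Fin N) ℂ))).re)) ∂(haarProbability (Matrix.specialUnitaryGroup (Fin N) ℂ)))
          - (N : ℝ) * b + (N : ℝ) ^ 2 / 2 * b ^ 2)
      ((∫ V, (Matrix.trace (1 - (V : Matrix (Fin N) (Fin N) ℂ))).re * Real.exp (-(β * (Matrix.trace (1 - (V : Matrix (Fin N) (Fin N) ℂ))).re))
            ∂(haarProbability (Matrix.specialUnitaryGroup (Fin N) ℂ)))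
          / (∫ V, Real.exp (-(β * (Matrix.trace (1 - (V : Matrix (Fin N) (Fin N) ℂ))).re)) ∂(haarProbability (Matrix.specialUnitaryGroup (Fin N) ℂ)))
        - (N : ℝ) + (N : ℝ) ^ 2 * β) β := by
  have hF := hasDerivAt_freeEnergy_SUN (N := N) β
  have h1 : HasDerivAt (fun b : ℝ => (N : ℝ) * b) ((N : ℝ) * 1) β := (hasDerivAt_id β).const_mul (N : ℝ)
  have h2 : HasDerivAt (fun b : ℝ => (N : ℝ) ^ 2 / 2 * b ^ 2) ((N : ℝ) ^ 2 / 2 * (2 * β)) β := by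
    have h := (hasDerivAt_pow 2 β).const_mul ((N : ℝ) ^ 2 / 2)
    simpa using h
  have h := (hF.sub h1).add h2
  refine h.congr_deriv ?_
  ring

/-- **`g′` IS DIFFERENTIABLE WITH `g″(β) = N² − Var_β ≥ 0`**, so `g′` is MONOTONE on ℝ (V56's `⟨s⟩′ = −Var` and §1). [folklore] -/
theorem gapDeriv_SUN_monotone :
    Monotone (fun b : ℝ =>
        (∫ V, (Matrix.trace (1 - (V : Matrix (Fin N) (Fin N) ℂ))).re * Real.exp (-(b * (Matrix.trace (1 - (V : Matrix (Fin N) (Fin N) ℂ))).re))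
            ∂(haarProbability (Matrix.specialUnitaryGroup (Fin N) ℂ)))
          / (∫ V, Real.exp (-(b * (Matrix.trace (1 - (V : Matrix (Fin N) (Fin N) ℂ))).re)) ∂(haarProbability (Matrix.specialUnitaryGroup (Fin N) ℂ)))
        - (N : ℝ) + (N : ℝ) ^ 2 * b) := by
  have hd : ∀ b : ℝ, HasDerivAt (fun b : ℝ =>
        (∫ V, (Matrix.trace (1 - (V : Matrix (Fin N) (Fin N) ℂ))).re * Real.exp (-(b * (Matrix.trace (1 - (V : Matrix (Fin N) (Fin N) ℂ))).re))
            ∂(haarProbability (Matrix.specialUnitaryGroup (Fin N) ℂ)))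
          / (∫ V, Real.exp (-(b * (Matrix.trace (1 - (V : Matrix (Fin N) (Fin N) ℂ))).re)) ∂(haarProbability (Matrix.specialUnitaryGroup (Fin N) ℂ)))
        - (N : ℝ) + (N : ℝ) ^ 2 * b)
      (-((∫ V, (Matrix.trace (1 - (V : Matrix (Fin N) (Fin N) ℂ))).re ^ 2 * Real.exp (-(b * (Matrix.trace (1 - (V : Matrix (Fin N) (Fin N) ℂ))).re))
              ∂(haarProbability (Matrix.specialUnitaryGroup (Fin N) ℂ)))
            / (∫ V, Real.exp (-(b * (Matrix.trace (1 - (V : Matrix (Fin N) (Fin N) ℂ))).re)) ∂(haarProbability (Matrix.specialUnitaryGroup (Fin N) ℂ)))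
          - ((∫ V, (Matrix.trace (1 - (V : Matrix (Fin N) (Fin N) ℂ))).re * Real.exp (-(b * (Matrix.trace (1 - (V : Matrix (Fin N) (Fin N) ℂ))).re))
                ∂(haarProbability (Matrix.specialUnitaryGroup (Fin N) ℂ)))
              / ∫ V, Real.exp (-(b * (Matrix.trace (1 - (V : Matrix (Fin N) (Fin N) ℂ))).re)) ∂(haarProbability (Matrix.specialUnitaryGroup (Fin N) ℂ))) ^ 2)
        + (N : ℝ) ^ 2 * 1) b := by
    intro b
    have hm := hasDerivAt_meanAction_SUN (N := N) b
    have h1 : HasDerivAt (fun b : ℝ => (N : ℝ) ^ 2 * b) ((N : ℝ) ^ 2 * 1) b := (hasDerivAt_id b).const_mul ((N : ℝ) ^ 2)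
    exact (hm.sub_const (N : ℝ)).add h1
  refine monotone_of_deriv_nonneg (fun b => (hd b).differentiableAt) fun b => ?_
  rw [(hd b).deriv]
  have hv := actionVariance_SUN_le_sq (N := N) b
  linarith

/-- **`N − N²β ≤ ⟨s⟩_β` FOR `β ≥ 0`** (`N ≥ 2`): `g′` is monotone with `g′(0) = ⟨s⟩₀ − N = 0`. [folklore] -/
theorem meanAction_ge_linear (hN : 2 ≤ N) {β : ℝ} (hβ : 0 ≤ β) :
    (N : ℝ) - (N : ℝ) ^ 2 * β ≤
      (∫ V, (Matrix.trace (1 - (V : Matrix (Fin N) (Fin N) ℂ))).re * Real.exp (-(β * (Matrix.trace (1 - (V : Matrix (Fin N) (Fin N) ℂ))).re))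
          ∂(haarProbability (Matrix.specialUnitaryGroup (Fin N) ℂ)))
        / ∫ V, Real.exp (-(β * (Matrix.trace (1 - (V : Matrix (Fin N) (Fin N) ℂ))).re)) ∂(haarProbability (Matrix.specialUnitaryGroup (Fin N) ℂ)) := by
  have h := gapDeriv_SUN_monotone (N := N) hβ
  simp only [mul_zero, add_zero] at h
  rw [meanAction_zero hN, sub_self] at h
  linarith

/-- **`⟨s⟩_β ≤ N − N²β` FOR `β ≤ 0`** (`N ≥ 2`; the mirror statement). [folklore] -/
theorem meanAction_le_linear (hN : 2 ≤ N) {β : ℝ} (hβ : β ≤ 0) :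
    (∫ V, (Matrix.trace (1 - (V : Matrix (Fin N) (Fin N) ℂ))).re * Real.exp (-(β * (Matrix.trace (1 - (V : Matrix (Fin N) (Fin N) ℂ))).re))
          ∂(haarProbability (Matrix.specialUnitaryGroup (Fin N) ℂ)))
        / ∫ V, Real.exp (-(β * (Matrix.trace (1 - (V : Matrix (Fin N) (Fin N) ℂ))).re)) ∂(haarProbability (Matrix.specialUnitaryGroup (Fin N) ℂ))
      ≤ (N : ℝ) - (N : ℝ) ^ 2 * β := by
  have h := gapDeriv_SUN_monotone (N := N) hβ
  simp only [mul_zero, add_zero] at h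
  rw [meanAction_zero hN, sub_self] at h
  linarith

/-! ### §3 The quadratic floor and the sandwich -/

/-- **THE QUADRATIC FLOOR, EVERY `N ≥ 2`, EVERY REAL `β`**: `N·β − (N²∕2)·β² ≤ −log Z_N(β)` (the gap function `g = −log Z_N − Nβ + (N²∕2)β²` has `g(0) = 0`,
`g′ ≤ 0` on `(−∞, 0]` and `g′ ≥ 0` on `[0, ∞)`). [folklore] -/
theorem freeEnergy_SUN_quadratic_floor (hN : 2 ≤ N) (β : ℝ) :
    (N : ℝ) * β - (N : ℝ) ^ 2 / 2 * β ^ 2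
      ≤ -Real.log (∫ V, Real.exp (-(β * (Matrix.trace (1 - (V : Matrix (Fin N) (Fin N) ℂ))).re)) ∂(haarProbability (Matrix.specialUnitaryGroup (Fin N) ℂ))) := by
  have hd := fun b : ℝ => hasDerivAt_gap_SUN (N := N) b
  have hg0 : -Real.log (∫ V, Real.exp (-((0 : ℝ) * (Matrix.trace (1 - (V : Matrix (Fin N) (Fin N) ℂ))).re)) ∂(haarProbability (Matrix.specialUnitaryGroup (Fin N) ℂ)))
      - (N : ℝ) * 0 + (N : ℝ) ^ 2 / 2 * (0 : ℝ) ^ 2 = 0 := by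
    simp only [zero_mul, neg_zero, Real.exp_zero, integral_const, probReal_univ, one_smul, Real.log_one, mul_zero, sub_zero, zero_pow two_ne_zero, add_zero]
  rcases le_total 0 β with hβ | hβ
  · -- monotone on `[0, ∞)`
    have hmono : MonotoneOn (fun b : ℝ =>
        -Real.log (∫ V, Real.exp (-(b * (Matrix.trace (1 - (V : Matrix (Fin N) (Fin N) ℂ))).re)) ∂(haarProbability (Matrix.specialUnitaryGroup (Fin N) ℂ)))
          - (N : ℝ) * b + (N : ℝ) ^ 2 / 2 * b ^ 2) (Set.Ici 0) := by
      refine monotoneOn_of_deriv_nonneg (convex_Ici 0) (fun b _ => (hd b).continuousAt.continuousWithinAt)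
        (fun b _ => (hd b).differentiableAt.differentiableWithinAt) fun b hb => ?_
      rw [interior_Ici] at hb
      rw [(hd b).deriv]
      have h := meanAction_ge_linear hN (le_of_lt hb)
      linarith
    have h := hmono (Set.mem_Ici.2 le_rfl) (Set.mem_Ici.2 hβ) hβ
    simp only at h
    rw [hg0] at h
    linarith
  · -- antitone on `(−∞, 0]`
    have hanti : AntitoneOn (fun b : ℝ =>
        -Real.log (∫ V, Real.exp (-(b * (Matrix.trace (1 - (V : Matrix (Fin N) (Fin N) ℂ))).re)) ∂(haarProbability (Matrix.specialUnitaryGroup (Fin N) ℂ)))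
          - (N : ℝ) * b + (N : ℝ) ^ 2 / 2 * b ^ 2) (Set.Iic 0) := by
      refine antitoneOn_of_deriv_nonpos (convex_Iic 0) (fun b _ => (hd b).continuousAt.continuousWithinAt)
        (fun b _ => (hd b).differentiableAt.differentiableWithinAt) fun b hb => ?_
      rw [interior_Iic] at hb
      rw [(hd b).deriv]
      have h := meanAction_le_linear hN (le_of_lt hb)
      linarith
    have h := hanti (Set.mem_Iic.2 hβ) (Set.mem_Iic.2 le_rfl) hβ
    simp only at h
    rw [hg0] at h
    linarith

/-- **THE SANDWICH, EVERY `N ≥ 2`, EVERY REAL `β`**: `−log Z_N(β) ∈ [N·β − (N²∕2)·β², N·β]` (floor §3, ceiling V50's `freeEnergy_SUN_le`) — explicit and uniform in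
`β`, constants `N` and `N²∕2` only. [folklore] -/
theorem freeEnergy_SUN_mem_Icc (hN : 2 ≤ N) (β : ℝ) :
    -Real.log (∫ V, Real.exp (-(β * (Matrix.trace (1 - (V : Matrix (Fin N) (Fin N) ℂ))).re)) ∂(haarProbability (Matrix.specialUnitaryGroup (Fin N) ℂ)))
      ∈ Set.Icc ((N : ℝ) * β - (N : ℝ) ^ 2 / 2 * β ^ 2) ((N : ℝ) * β) :=
  ⟨freeEnergy_SUN_quadratic_floor hN β, freeEnergy_SUN_le hN β⟩

end Summit.QuantumFields.BalabanUV.T4Continuum.NE7b.CompactFibreFreeEnergySUNQuadraticFloor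

end
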